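import Literature.NumberTheory.LFunctions.SiegelTatuzawaHoffsteinTripleMaster
import Literature.NumberTheory.LFunctions.SiegelTatuzawaHoffsteinLemmaThree
import Literature.NumberTheory.LFunctions.DirichletLOneHalfLogBoundOdd
import HarnessLib

/-!
# Hoffstein 1980, Theorem 1′ (Acta Arith. 38, p. 172) — the discharge of `hoffstein1980_theorem1'`

Topic `Literature/NumberTheory/LFunctions`. Everything in this file is PROVED; its last theorem is
`Literature.NumberTheory.LFunctions.hoffstein1980_theorem1'_holds : hoffstein1980_theorem1'`, discharging
the named fact of `SiegelTatuzawaExplicit.lean`: J. Hoffstein, *On the Siegel–Tatuzawa theorem*, Acta Arith.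
**38** (1980) 167–174, THEOREM 1′ (p. 172): "If `|d| ≥ |d′| > 10⁶`,
`L(1, χ) > 1/(.520 log|d′| (1 + log|d|/log|d′|)² |dd′|^{.138/log|d′|})`" — in the typed form: `χ, χ′` real
primitive mod `q ≥ q′ > 10⁶` with different value functions and `L(1,χ′) < 1/(7.735 log q′)`, conclusion
`min(1/(7.735 log q), 1/(.520 log q′ (1 + log q/log q′)² (qq′)^{.138/log q′})) < L(1,χ)`.

We follow §3 (pp. 170–172): (5) ⇒ (6) a real zero `β′ ∈ (1 − 1/(11.657 log q′), 1)` of `L(s,χ′)`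
(`Hoffstein1980.exists_realZero_of_lOne_le` of `SiegelTatuzawaHoffsteinLemmaThree.lean`, Lemma 1 with the proof's constant `1.511`); (16) Lemma 3
(`hoffstein1980_lemma3_holds`): `1 − β′ > 1/(5.828 log qq′)` or `L(1,χ) > 1/(7.735 log q)` (then done);
(7)–(11) the master inequality `hoffstein_master3` for `F = ζ L_χ L_χ′ L_ψ`, `ψ` the primitive character
inducing `χχ′` (`exists_primitive_inducer`), at `x = (qq′)^{3/2}` (the source: `x = |D_K|^A`,
`A = 2/(3/2+β′) ≈ .8`, `|D_K| ≤ (dd′)²`); (14) `L(1,ψ) ≤ ½ log k + 1.3 ≤ ½ log(qq′) + 1.3`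
(`Louboutin2001.norm_LFunction_one_le_of_isPrimitive`, the tree's kernel replacement of Tatuzawa's
Lemmas 4–5 / `.589 log|dd′|`); (15) `x^{1−β′} = (qq′)^{1.5(1−β′)} ≤ (qq′)^{1.5/(11.657 log q′)} =
(qq′)^{.1287/log q′} ≤ (qq′)^{.138/log q′}`. NUMERICS (all with slack): `6!·I ≥ Σ_{m≤200}(1/m² − 15m²/x²)
≥ 1.6398` (squares; the source's fourth powers give `1.080`), error `C₃ x^{−3/2} x^{1−β′} ≤ 3.9 (qq′)^{−1/5}
≤ 0.039` (`ζ(3/2) ≤ 2.77`, `π⁴ > 97.4`, `k ≤ qq′`), so `L(1,χ)L(1,χ′)L(1,ψ) x^{1−β′} ≥ 1.6 (1 − β′)`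
(print: `0.981`); the final inequality needs `1.6·7.735·c₀/5.828 > ½ + 1.3/log(qq′)` for the lead constant
`c₀`, i.e. any `c₀ ≥ 0.26` works: `Hoffstein1980.theorem1'_of_le` states the bound with `c₀ = 0.5` (the margin
`0.5·e^{.138} < .596` is what the printed constants of Theorem 1 need), and `hoffstein1980_theorem1'_holds`
weakens it to the printed `.520`.

## References

* J. Hoffstein, On the Siegel–Tatuzawa theorem, Acta Arith. 38 (1980) 167–174, §3, Theorem 1′ p. 172,
  with (5)–(6), (7)–(11), (14)–(16), pp. 170–172. [Hoffstein1980SiegelTatuzawa]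
-/

noncomputable section

open Complex DirichletCharacter
open scoped Real

namespace Literature.NumberTheory.LFunctions.Hoffstein1980

open Literature.NumberTheory.LFunctions.Booker2006Turing

/-! ### Numerical constants -/

/-- `Σ_{m<n} (m+1)² = n(n+1)(2n+1)/6`. [folklore] -/
private lemma sum_range_succ_sq' (n : ℕ) :
    ∑ m ∈ Finset.range n, ((m : ℝ) + 1) ^ 2 = (n : ℝ) * (n + 1) * (2 * n + 1) / 6 := by
  induction n with
  | zero => simp
  | succ n ih => rw [Finset.sum_range_succ, ih]; push_cast; ring

/-- `π⁴ > 97.4`. [folklore] -/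
private lemma pi_pow_four_gt' : (97.4 : ℝ) < π ^ 4 := by
  have h := Real.pi_gt_d6
  have h2 : (3.141592 : ℝ) ^ 2 < π ^ 2 := by nlinarith [Real.pi_pos]
  nlinarith [h2]

/-- `a^{-1/2} ≤ b` from `1 ≤ a b²`. [folklore] -/
private lemma rpow_neg_half_le' {a b : ℝ} (ha : 0 < a) (hb : 0 < b) (h : 1 ≤ a * b ^ 2) :
    a ^ (-(1 / 2 : ℝ)) ≤ b := by
  rw [Real.rpow_neg ha.le, ← Real.sqrt_eq_rpow, inv_le_comm₀ (Real.sqrt_pos.2 ha) hb,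
    Real.le_sqrt (inv_pos.2 hb).le ha.le, inv_pow]
  calc (b ^ 2)⁻¹ = (b ^ 2)⁻¹ * 1 := (mul_one _).symm
    _ ≤ (b ^ 2)⁻¹ * (a * b ^ 2) := by gcongr
    _ = a := by field_simp

/-- `Z₀(3/2) = ζ(3/2) ≤ 1 + 2^{-3/2} + ∫₂^∞ t^{-3/2} dt ≤ 2.77` (true value `2.612…`).
[cite: Hoffstein1980SiegelTatuzawa, §3 (7) p. 171] -/
theorem bigZ_three_halves_le : bigZ (3 / 2) ≤ 2.77 := by
  rw [bigZ_eq_tsum (by norm_num)]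
  refine Real.tsum_le_of_sum_range_le (fun n ↦ by positivity) fun N ↦ ?_
  have hmono : ∑ n ∈ Finset.range N, ((n + 1 : ℕ) : ℝ) ^ (-(3 / 2 : ℝ)) ≤
      ∑ n ∈ Finset.range (max N 2), ((n + 1 : ℕ) : ℝ) ^ (-(3 / 2 : ℝ)) :=
    Finset.sum_le_sum_of_subset_of_nonneg (Finset.range_mono (le_max_left _ _))
      fun _ _ _ ↦ by positivity
  refine hmono.trans ?_
  obtain ⟨M, hMdef⟩ : ∃ M, M = max N 2 := ⟨_, rfl⟩
  have hM2 : 2 ≤ M := hMdef ▸ le_max_right _ _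
  rw [← hMdef, Finset.range_eq_Ico, ← Finset.sum_Ico_consecutive _ (Nat.zero_le 2) hM2]
  have hhead : ∑ n ∈ Finset.Ico 0 2, ((n + 1 : ℕ) : ℝ) ^ (-(3 / 2 : ℝ)) =
      1 + (8 : ℝ) ^ (-(1 / 2 : ℝ)) := by
    rw [show Finset.Ico 0 2 = {0, 1} by rfl, Finset.sum_pair (by norm_num)]
    norm_num
    rw [show (-(3 / 2 : ℝ)) = ((3 : ℕ) : ℝ) * (-(1 / 2 : ℝ)) by norm_num,
      Real.rpow_natCast_mul (by norm_num : (0 : ℝ) ≤ 2)]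
    norm_num
  have hanti : AntitoneOn (fun x : ℝ ↦ x ^ (-(3 / 2 : ℝ))) (Set.Icc ((2 : ℕ) : ℝ) ((M : ℕ) : ℝ)) := by
    intro x hx y _ hxy
    have hx2 : (2 : ℝ) ≤ x := by simpa using hx.1
    exact Real.rpow_le_rpow_of_nonpos (by linarith) hxy (by norm_num)
  have hcmp := AntitoneOn.sum_le_integral_Ico (f := fun x : ℝ ↦ x ^ (-(3 / 2 : ℝ))) hM2 hanti
  have hMr : (2 : ℝ) ≤ (M : ℝ) := by exact_mod_cast hM2
  have hint : ∫ x in ((2 : ℕ) : ℝ)..((M : ℕ) : ℝ), x ^ (-(3 / 2 : ℝ)) ≤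
      2 * (2 : ℝ) ^ (-(1 / 2 : ℝ)) := by
    push_cast
    rw [integral_rpow (Or.inr ⟨by norm_num, by
      rw [Set.mem_uIcc]; push Not
      constructor <;> intro h <;> linarith⟩)]
    rw [show (-(3 / 2 : ℝ) + 1) = -(1 / 2) by norm_num]
    have hMpos : (0 : ℝ) ≤ (M : ℝ) ^ (-(1 / 2 : ℝ)) := by positivity
    have : (((M : ℝ)) ^ (-(1 / 2 : ℝ)) - 2 ^ (-(1 / 2 : ℝ))) / (-(1 / 2 : ℝ)) =
        2 * (2 ^ (-(1 / 2 : ℝ)) - (M : ℝ) ^ (-(1 / 2 : ℝ))) := by ring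
    rw [this]
    linarith
  have h8 : (8 : ℝ) ^ (-(1 / 2 : ℝ)) ≤ 0.3536 := rpow_neg_half_le' (by norm_num) (by norm_num) (by norm_num)
  have h2' : (2 : ℝ) ^ (-(1 / 2 : ℝ)) ≤ 0.7072 := rpow_neg_half_le' (by norm_num) (by norm_num) (by norm_num)
  rw [hhead]
  linarith

/-- `log r > 13.1697` for `r > 10⁶` (`2¹⁹ < 10⁶`). [folklore] -/
private lemma log_gt_of_gt_ten6' {r : ℝ} (hr : 10 ^ 6 < r) : (13.1697 : ℝ) < Real.log r := by
  have h19 : Real.log ((2 : ℝ) ^ 19) < Real.log r :=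
    Real.log_lt_log (by positivity) (by linarith [show ((2 : ℝ) ^ 19) < 10 ^ 6 by norm_num])
  rw [Real.log_pow] at h19
  push_cast at h19
  linarith [Real.log_two_gt_d9]

/-- `N^{1/5} ≥ 100` for `N ≥ 10¹⁰`. [folklore] -/
private lemma rpow_fifth_ge {N : ℝ} (hN : (10 : ℝ) ^ 10 ≤ N) : (100 : ℝ) ≤ N ^ (1 / 5 : ℝ) := by
  have hN0 : 0 ≤ N := le_trans (by norm_num) hN
  have h5 : (N ^ (1 / 5 : ℝ)) ^ (5 : ℕ) = N := by
    rw [← Real.rpow_natCast, ← Real.rpow_mul hN0]; norm_num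
  have hy : 0 ≤ N ^ (1 / 5 : ℝ) := Real.rpow_nonneg hN0 _
  by_contra hlt
  push Not at hlt
  have : (N ^ (1 / 5 : ℝ)) ^ (5 : ℕ) < 100 ^ 5 := pow_lt_pow_left₀ hlt hy (by norm_num)
  rw [h5] at this
  linarith [this]

/-- For a quadratic non-trivial `χ`, `L(1, χ)` is real and positive (real part `> 0`, imaginary part `0`,
norm `=` real part). [folklore] -/
private lemma LFunction_one_re_pos' {n : ℕ} [NeZero n] {φ : DirichletCharacter ℂ n} (hφ1 : φ ≠ 1)
    (h2 : φ ^ 2 = 1) : 0 < (φ.LFunction 1).re ∧ ‖φ.LFunction 1‖ = (φ.LFunction 1).re := by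
  have him : (φ.LFunction 1).im = 0 := by
    have := DirichletAbel.LFunction_ofReal_im_eq_zero φ hφ1 h2 (σ := 1) one_pos
    simpa using this
  have hpos : 0 < (φ.LFunction 1).re := by
    have := DirichletAbel.LFunction_ofReal_re_pos_of_forall_ne_zero φ hφ1 h2 one_pos le_rfl
      fun σ h1 h2 ↦ by
        have hσ : σ = 1 := le_antisymm h2 h1
        subst hσ
        exact DirichletCharacter.LFunction_ne_zero_of_one_le_re φ (Or.inl hφ1) (by simp)
    simpa using this
  refine ⟨hpos, ?_⟩
  rw [← Complex.re_add_im (φ.LFunction 1), him]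
  simp [abs_of_pos hpos]

/-- A primitive character modulo `n > 1` is non-trivial. [folklore] -/
private lemma ne_one_of_isPrimitive₄ {n : ℕ} [NeZero n] {φ : DirichletCharacter ℂ n}
    (hφ : φ.IsPrimitive) (hn : 1 < n) : φ ≠ 1 := by
  rintro rfl
  have h : (1 : DirichletCharacter ℂ n).conductor = n := hφ
  rw [DirichletCharacter.conductor_one] at h; omega



/-- The error constant: `720 ζ(3/2)⁴/(7 (2π)⁴) ≤ 3.9`. [cite: Hoffstein1980SiegelTatuzawa, §3 (7) p. 171] -/
theorem errConst3_le : 720 * bigZ (3 / 2) ^ 4 / (7 * (2 * π) ^ 4) ≤ (3.9 : ℝ) := by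
  have hZ := bigZ_three_halves_le
  have hπ4 := pi_pow_four_gt'
  have hZ0 : 0 ≤ bigZ (3 / 2) := (bigZ_pos (by norm_num)).le
  have hZ4 : bigZ (3 / 2) ^ 4 ≤ 58.9 := by
    calc bigZ (3 / 2) ^ 4 ≤ (2.77 : ℝ) ^ 4 := pow_le_pow_left₀ hZ0 hZ 4
      _ ≤ 58.9 := by norm_num
  rw [div_le_iff₀ (by positivity)]
  have e4 : (2 * π) ^ 4 = 16 * π ^ 4 := by ring
  have h1 : 720 * bigZ (3 / 2) ^ 4 ≤ 720 * 58.9 := by linarith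
  have h2 : (3.9 : ℝ) * (7 * (16 * 97.4)) ≤ 3.9 * (7 * (16 * π ^ 4)) := by gcongr
  rw [e4]; linarith

/-- The squares sum at `x ≥ 10⁶`: `Σ_{m≤200}(1/m² − 15m²/x²) ≥ 1.6398` (the source's (9) prints `1.080` for
fourth powers `n ≤ 5`). [cite: Hoffstein1980SiegelTatuzawa, §3 (9) p. 171] -/
theorem sum200_ge {x : ℝ} (hx : (10 : ℝ) ^ 6 ≤ x) :
    (1.6398 : ℝ) ≤ ∑ m ∈ Finset.range 200, (1 / ((m : ℝ) + 1) ^ 2 - 15 * ((m : ℝ) + 1) ^ 2 / x ^ 2) := by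
  rw [Finset.sum_sub_distrib]
  have hA := sum_inv_sq_200_ge
  have hB : ∑ m ∈ Finset.range 200, 15 * ((m : ℝ) + 1) ^ 2 / x ^ 2 = 15 * 2686700 / x ^ 2 := by
    rw [← Finset.sum_div, ← Finset.mul_sum, sum_range_succ_sq']; norm_num
  rw [hB]
  have hx0 : 0 < x := lt_of_lt_of_le (by norm_num) hx
  have hx2 : (10 : ℝ) ^ 12 ≤ x ^ 2 := by nlinarith
  have : 15 * 2686700 / x ^ 2 ≤ (0.0001 : ℝ) := by
    rw [div_le_iff₀ (by positivity)]; linarith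
  linarith

end Literature.NumberTheory.LFunctions.Hoffstein1980

namespace Literature.NumberTheory.LFunctions

open Hoffstein1980 Literature.NumberTheory.LFunctions.Booker2006Turing

/-- **Hoffstein 1980, Theorem 1′ (p. 172), SHARPENED: lead constant `0.5` for the printed `.520`, and the
non-strict (5) `L(1,χ′) ≤ 1/(7.735 log q′)`.** "If `|d| ≥ |d′| > 10⁶`,
`L(1, χ) > 1/(.520 log|d′| (1 + log|d|/log|d′|)² |dd′|^{.138/log|d′|})`" — for `χ ≠ χ′` real primitive
mod `q ≥ q′ > 10⁶` (different value functions), conclusion in the `min`-form with `1/(7.735 log q)`. Proof: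
§3 as described in the module docstring (line moved to `Re(s+β′) = −½`; `x = (qq′)^{3/2}`; the kernel bound
has lead constant `≈ 0.26`, stated here with `0.5` — the printed `.520` is `hoffstein1980_theorem1'_holds`;
the margin `0.5 · e^{.138} = 0.574 < .596` is what the printed constants of Theorem 1 need, Hoffstein's
`.520 · e^{.138} = .5969` being rounded DOWN to `.596` on p. 167; the slack of Lemma 1 (`1.511`) admits
equality in (5), needed for the boundary case of the exception in Theorem 1).
[cite: Hoffstein1980SiegelTatuzawa, Theorem 1′ p. 172 with §3 pp. 170–172] -/
theorem Hoffstein1980.theorem1'_of_le {q : ℕ} [NeZero q] (χ : DirichletCharacter ℂ q) {q' : ℕ} [NeZero q']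
    (χ' : DirichletCharacter ℂ q') (hχp : χ.IsPrimitive) (hχq : χ.IsQuadratic) (hχ1 : χ ≠ 1)
    (hχ'p : χ'.IsPrimitive) (hχ'q : χ'.IsQuadratic) (hχ'1 : χ' ≠ 1)
    (hne : (fun n : ℕ ↦ χ n) ≠ fun n : ℕ ↦ χ' n) (hq'6 : (10 ^ 6 : ℝ) < q') (hqq' : q' ≤ q)
    (hL' : (χ'.LFunction 1).re ≤ 1 / (7.735 * Real.log q')) :
    min (1 / (7.735 * Real.log q))
        (1 / (0.5 * Real.log q' * (1 + Real.log q / Real.log q') ^ 2 *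
          ((q : ℝ) * q') ^ (0.138 / Real.log q'))) < (χ.LFunction 1).re := by
  -- basic sizes
  have hq'r : (10 ^ 6 : ℝ) < q' := hq'6
  have hqq'r : (q' : ℝ) ≤ q := by exact_mod_cast hqq'
  have hqr : (10 ^ 6 : ℝ) < q := lt_of_lt_of_le hq'r hqq'r
  have hq1 : 1 < q := by exact_mod_cast (lt_trans (by norm_num : (1:ℝ) < 10 ^ 6) hqr)
  have hq'1 : 1 < q' := by exact_mod_cast (lt_trans (by norm_num : (1:ℝ) < 10 ^ 6) hq'r)
  have hq0 : (0 : ℝ) < q := by linarith only [hqr]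
  have hq'0 : (0 : ℝ) < q' := by linarith only [hq'r]
  have hlq' := log_gt_of_gt_ten6' hq'r
  have hlq := log_gt_of_gt_ten6' hqr
  have hlq'0 : 0 < Real.log q' := by linarith only [hlq']
  have hlq0 : 0 < Real.log q := by linarith only [hlq]
  set N : ℝ := (q : ℝ) * q' with hN
  have hN0 : 0 < N := by positivity
  have hN12 : (10 : ℝ) ^ 12 ≤ N := by
    rw [hN]
    calc (10 : ℝ) ^ 12 = 10 ^ 6 * 10 ^ 6 := by norm_num
      _ ≤ (q : ℝ) * q' := mul_le_mul (hq'r.le.trans hqq'r) hq'r.le (by norm_num) hq0.le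
  have hN1 : (1 : ℝ) ≤ N := le_trans (by norm_num) hN12
  have hlN : Real.log N = Real.log q + Real.log q' := by rw [hN, Real.log_mul hq0.ne' hq'0.ne']
  have hlN26 : (26 : ℝ) < Real.log N := by rw [hlN]; linarith only [hlq, hlq']
  have hlN0 : 0 < Real.log N := by linarith only [hlN26]
  have h2 : χ ^ 2 = 1 := hχq.sq_eq_one
  have h2' : χ' ^ 2 = 1 := hχ'q.sq_eq_one
  -- `L(1,χ) > 0`, `L(1,χ′) > 0`
  obtain ⟨hLpos, -⟩ := LFunction_one_re_pos' hχ1 h2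
  obtain ⟨hL'pos, -⟩ := LFunction_one_re_pos' hχ'1 h2'
  -- (5) ⇒ (6): the real zero `β′`
  obtain ⟨β, hz, hβlo, hβ1, -, -⟩ := exists_realZero_of_lOne_le hχ'p hχ'q hq'6.le hL'
  have hκ0 : 0 < 1 - β := by linarith only [hβ1]
  have hκ : 1 - β ≤ 1 / (11.657 * Real.log q') := by linarith only [hβlo]
  have hκ' : (1 - β) * Real.log q' ≤ 1 / 11.657 := by
    rw [le_div_iff₀ (by positivity)] at hκ; rw [le_div_iff₀ (by norm_num)]; linarith only [hκ]
  have hκ1 : 1 - β < 0.0066 := by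
    have h3 : (1 - β) * 13.1697 ≤ (1 - β) * Real.log q' := mul_le_mul_of_nonneg_left hlq'.le hκ0.le
    have : (1 / 11.657 : ℝ) < 0.0066 * 13.1697 := by norm_num
    nlinarith only [h3, hκ', this, hκ0]
  have hβ0 : 1 / 2 < β := by linarith only [hκ1]
  -- (16): Lemma 3
  rcases hoffstein1980_lemma3_holds q χ q' χ' hχp hχq hχ1 hχ'p hχ'q hχ'1 hne hq'6.le hqq' β hβ1 hz
    with h16 | hdone
  swap
  · exact lt_of_le_of_lt (min_le_left _ _) hdone
  have h16' : 1 / (5.828 * Real.log N) < 1 - β := by rw [hN]; exact h16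
  -- the third character `ψ`
  obtain ⟨k, hkI, ψ, hk1, hkdvd, hψp, hψ2, hψ1, hlink, -⟩ :=
    exists_primitive_inducer χ χ' hχp hχ'p h2 h2' hne
  obtain ⟨hLψpos, hLψnorm⟩ := LFunction_one_re_pos' hψ1 hψ2
  have hkle : (k : ℝ) ≤ N := by
    rw [hN]
    exact_mod_cast Nat.le_of_dvd (Nat.pos_of_ne_zero (mul_ne_zero (NeZero.ne q) (NeZero.ne q'))) hkdvd
  have hk0 : (0 : ℝ) < k := by exact_mod_cast (zero_lt_one.trans hk1)
  -- (14): `L(1,ψ) ≤ ½ log k + 1.3 ≤ ½ log N + 1.3 =: u`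
  set u : ℝ := Real.log N / 2 + 1.3 with hu
  have hLψle : (ψ.LFunction 1).re ≤ u := by
    have h := Louboutin2001.norm_LFunction_one_le_of_isPrimitive (χ := ψ) hψp hψ1
    rw [hLψnorm] at h
    have : Real.log k ≤ Real.log N := Real.log_le_log hk0 hkle
    rw [hu]; linarith only [h, this]
  have hu0 : 0 < u := by rw [hu]; positivity
  -- the choice `x = N^{3/2}`
  set x : ℝ := N ^ (3 / 2 : ℝ) with hxdef
  have hx0 : 0 < x := Real.rpow_pos_of_pos hN0 _
  have hxN : N ≤ x := by
    rw [hxdef]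
    calc N = N ^ (1 : ℝ) := (Real.rpow_one N).symm
      _ ≤ N ^ (3 / 2 : ℝ) := Real.rpow_le_rpow_of_exponent_le hN1 (by norm_num)
  have hx4 : (40000 : ℝ) ≤ x := le_trans (by linarith only [hN12]) hxN
  -- the master inequality
  have hFβ : hoffF χ χ' ψ β = 0 := hoffF_eq_zero_of_LFunction_eq_zero hz
  have hM := hoffstein_master3 hq1 hq'1 hk1 hχp hχ'p hψp h2 h2' hψ2 hlink hβ0 hβ1 hFβ hx4
  -- numerics (a): the squares sum
  have hSm := sum200_ge (le_trans (le_trans (by norm_num) hN12) hxN)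
  -- numerics (b): the error term `C₃ x^{-3/2} ≤ 3.9 N² N^{-9/4} = 3.9 N^{-1/4}`
  have hx32 : x ^ (-(3 / 2 : ℝ)) = N ^ (-(9 / 4 : ℝ)) := by
    rw [hxdef, ← Real.rpow_mul hN0.le]; norm_num
  have hE : hoffErr3 q q' k * x ^ (-(3 / 2 : ℝ)) ≤ 3.9 * N ^ (-(1 / 4 : ℝ)) := by
    rw [hoffErr3, hx32]
    have hqqk : (q : ℝ) * q' * k ≤ N * N := by rw [hN]; gcongr
    have hNN : N * N * N ^ (-(9 / 4 : ℝ)) = N ^ (-(1 / 4 : ℝ)) := by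
      rw [show N * N = N ^ (2 : ℝ) by rw [Real.rpow_two]; ring, ← Real.rpow_add hN0]; norm_num
    have hZ0 : 0 ≤ bigZ (3 / 2) := (bigZ_pos (by norm_num)).le
    calc 720 * ((q : ℝ) * q' * k) * bigZ (3 / 2) ^ 4 / (7 * (2 * π) ^ 4) * N ^ (-(9 / 4 : ℝ))
        = (720 * bigZ (3 / 2) ^ 4 / (7 * (2 * π) ^ 4)) * (((q : ℝ) * q' * k) * N ^ (-(9 / 4 : ℝ))) := by
          ring
      _ ≤ 3.9 * ((N * N) * N ^ (-(9 / 4 : ℝ))) := by gcongr; exact errConst3_le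
      _ = 3.9 * N ^ (-(1 / 4 : ℝ)) := by rw [hNN]
  --   `x^{1−β} = N^{1.5(1−β)} ≤ N^{1/100}` and `N^{1/100 − 1/4} ≤ N^{−1/5} ≤ 1/100`
  have hxκ_le : x ^ (1 - β) ≤ N ^ (1 / 100 : ℝ) := by
    rw [hxdef, ← Real.rpow_mul hN0.le]
    exact Real.rpow_le_rpow_of_exponent_le hN1 (by linarith only [hκ1])
  have hN5 : N ^ (-(1 / 5 : ℝ)) ≤ 1 / 100 := by
    have h := rpow_fifth_ge (N := N) (le_trans (by norm_num) hN12)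
    rw [Real.rpow_neg hN0.le]
    exact (inv_le_inv₀ (by positivity) (by norm_num)).2 h |>.trans (by norm_num)
  have hEx : hoffErr3 q q' k * x ^ (-(3 / 2 : ℝ)) * x ^ (1 - β) ≤ 0.039 := by
    have h1 : hoffErr3 q q' k * x ^ (-(3 / 2 : ℝ)) * x ^ (1 - β) ≤
        3.9 * N ^ (-(1 / 4 : ℝ)) * N ^ (1 / 100 : ℝ) :=
      mul_le_mul hE hxκ_le (Real.rpow_pos_of_pos hx0 _).le (by positivity)
    have h2 : N ^ (-(1 / 4 : ℝ)) * N ^ (1 / 100 : ℝ) ≤ N ^ (-(1 / 5 : ℝ)) := by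
      rw [← Real.rpow_add hN0]
      exact Real.rpow_le_rpow_of_exponent_le hN1 (by norm_num)
    calc hoffErr3 q q' k * x ^ (-(3 / 2 : ℝ)) * x ^ (1 - β)
        ≤ 3.9 * (N ^ (-(1 / 4 : ℝ)) * N ^ (1 / 100 : ℝ)) := by rw [← mul_assoc]; exact h1
      _ ≤ 3.9 * N ^ (-(1 / 5 : ℝ)) := by gcongr
      _ ≤ 3.9 * (1 / 100) := by gcongr
      _ = 0.039 := by norm_num
  -- from the master inequality to `1.6 (1−β) x^{−(1−β)} ≤ L(1,χ) L(1,χ′) L(1,ψ)`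
  set Sm : ℝ := ∑ m ∈ Finset.range 200, (1 / ((m : ℝ) + 1) ^ 2 - 15 * ((m : ℝ) + 1) ^ 2 / x ^ 2)
    with hSmdef
  set P : ℝ := (χ.LFunction 1).re * ((χ'.LFunction 1).re * (ψ.LFunction 1).re) with hP
  set E : ℝ := hoffErr3 q q' k * x ^ (-(3 / 2 : ℝ)) with hEdef
  have hxκ0 : 0 < x ^ (-(1 - β)) := Real.rpow_pos_of_pos hx0 _
  have hxinv : x ^ (-(1 - β)) * x ^ (1 - β) = 1 := by rw [← Real.rpow_add hx0]; simp
  have hA : 1.6 * (1 - β) * x ^ (-(1 - β)) ≤ P := by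
    have h1 : x ^ (-(1 - β)) * Sm - E = x ^ (-(1 - β)) * (Sm - E * x ^ (1 - β)) := by
      have : E = x ^ (-(1 - β)) * (E * x ^ (1 - β)) := by
        rw [show x ^ (-(1 - β)) * (E * x ^ (1 - β)) = E * (x ^ (-(1 - β)) * x ^ (1 - β)) by ring,
          hxinv, mul_one]
      conv_lhs => rw [this]
      ring
    rw [h1] at hM
    have h2 : (1.6 : ℝ) ≤ Sm - E * x ^ (1 - β) := by linarith only [hSm, hEx]
    calc 1.6 * (1 - β) * x ^ (-(1 - β)) = (1 - β) * (x ^ (-(1 - β)) * 1.6) := by ring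
      _ ≤ (1 - β) * (x ^ (-(1 - β)) * (Sm - E * x ^ (1 - β))) := by gcongr
      _ ≤ P := hM
  -- (15): `x^{−(1−β)} ≥ N^{−.138/log q′}`
  set e : ℝ := 0.138 / Real.log q' with he
  have he0 : 0 < e := by rw [he]; positivity
  have hxκ_ge : N ^ (-e) ≤ x ^ (-(1 - β)) := by
    rw [hxdef, ← Real.rpow_mul hN0.le]
    refine Real.rpow_le_rpow_of_exponent_le hN1 ?_
    have : 3 / 2 * (1 - β) ≤ e := by
      rw [he, le_div_iff₀ hlq'0]; nlinarith only [hκ', hκ0]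
    linarith only [this]
  have hNe0 : 0 < N ^ (-e) := Real.rpow_pos_of_pos hN0 _
  have hNepos : 0 < N ^ e := Real.rpow_pos_of_pos hN0 _
  -- the target in closed form: `T = log q′/(.520 (log N)² N^{e})`
  have hNe : N ^ e = ((q : ℝ) * q') ^ (0.138 / Real.log q') := by rw [hN, he]
  have hT : 1 / (0.5 * Real.log q' * (1 + Real.log q / Real.log q') ^ 2 *
      ((q : ℝ) * q') ^ (0.138 / Real.log q')) = Real.log q' / (0.5 * Real.log N ^ 2 * N ^ e) := by
    rw [← hNe, hlN]
    field_simp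
    ring
  rw [hT]
  refine lt_of_le_of_lt (min_le_right _ _) ?_
  -- final comparison: `T · (ℓ′ u) ≤ A₀ < A ≤ P ≤ L(1,χ) · (ℓ′ u)`
  set ℓ : ℝ := 1 / (7.735 * Real.log q') with hℓ
  have hℓ0 : 0 < ℓ := by rw [hℓ]; positivity
  have hPle : P ≤ (χ.LFunction 1).re * (ℓ * u) := by
    have hL'le : (χ'.LFunction 1).re ≤ ℓ := hL'
    rw [hP]
    gcongr
  have hA0 : 1.6 * (1 / (5.828 * Real.log N)) * N ^ (-e) < 1.6 * (1 - β) * x ^ (-(1 - β)) := by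
    calc 1.6 * (1 / (5.828 * Real.log N)) * N ^ (-e)
        ≤ 1.6 * (1 / (5.828 * Real.log N)) * x ^ (-(1 - β)) := by gcongr
      _ < 1.6 * (1 - β) * x ^ (-(1 - β)) := by gcongr
  have hTle : Real.log q' / (0.5 * Real.log N ^ 2 * N ^ e) * (ℓ * u) ≤
      1.6 * (1 / (5.828 * Real.log N)) * N ^ (-e) := by
    have e1 : Real.log q' / (0.5 * Real.log N ^ 2 * N ^ e) * (ℓ * u) =
        u / (0.5 * 7.735 * Real.log N ^ 2 * N ^ e) := by
      rw [hℓ]; field_simp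
    have e2 : 1.6 * (1 / (5.828 * Real.log N)) * N ^ (-e) = 1.6 / (5.828 * Real.log N * N ^ e) := by
      rw [Real.rpow_neg hN0.le]; field_simp
    rw [e1, e2, div_le_div_iff₀ (by positivity) (by positivity)]
    have key : u * 5.828 ≤ 1.6 * 0.5 * 7.735 * Real.log N := by rw [hu]; linarith only [hlN26]
    calc u * (5.828 * Real.log N * N ^ e) = (u * 5.828) * (Real.log N * N ^ e) := by ring
      _ ≤ (1.6 * 0.5 * 7.735 * Real.log N) * (Real.log N * N ^ e) :=
          mul_le_mul_of_nonneg_right key (by positivity)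
      _ = 1.6 * (0.5 * 7.735 * Real.log N ^ 2 * N ^ e) := by ring
  have hchain : Real.log q' / (0.5 * Real.log N ^ 2 * N ^ e) * (ℓ * u) <
      (χ.LFunction 1).re * (ℓ * u) := by linarith only [hTle, hA0, hA, hPle]
  exact lt_of_mul_lt_mul_right hchain (by positivity)

/-- **Hoffstein 1980, Theorem 1′ (p. 172) — DISCHARGED.** "THEOREM 1′. If `|d| ≥ |d′| > 10⁶`,
`L(1, χ) > 1/(.520 log|d′| (1 + log|d|/log|d′|)² |dd′|^{.138/log|d′|})`" (with the standing hypotheses of §3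
made explicit in the named fact: `χ ≠ χ′` real primitive mod `q ≥ q′ > 10⁶`, (5) `L(1,χ′) < 1/(7.735 log q′)`;
conclusion in the `min`-form with `1/(7.735 log q)`). [cite: Hoffstein1980SiegelTatuzawa, Theorem 1′ p. 172] -/
theorem hoffstein1980_theorem1'_holds : hoffstein1980_theorem1' := by
  intro q _ χ q' _ χ' hχp hχq hχ1 hχ'p hχ'q hχ'1 hne hq'6 hqq' hL'
  have h := Hoffstein1980.theorem1'_of_le χ χ' hχp hχq hχ1 hχ'p hχ'q hχ'1 hne hq'6 hqq' hL'.le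
  refine lt_of_le_of_lt ?_ h
  -- `1/(.520 X) ≤ 1/(0.5 X)` for the positive `X`
  have hq'r : (10 ^ 6 : ℝ) < q' := hq'6
  have hq'0 : (0 : ℝ) < q' := lt_trans (by norm_num) hq'r
  have hq0 : (0 : ℝ) < q := lt_of_lt_of_le hq'0 (by exact_mod_cast hqq')
  have hlq' : 0 < Real.log q' := Real.log_pos (lt_trans (by norm_num) hq'r)
  have hX : 0 < Real.log q' * (1 + Real.log q / Real.log q') ^ 2 *
      ((q : ℝ) * q') ^ (0.138 / Real.log q') := by
    have hlq : 0 ≤ Real.log q := Real.log_nonneg (by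
      have : (1 : ℝ) < q' := lt_trans (by norm_num) hq'r
      linarith [show (q' : ℝ) ≤ q by exact_mod_cast hqq'])
    have : 0 < (1 + Real.log q / Real.log q') ^ 2 := by positivity
    have : 0 < ((q : ℝ) * q') ^ (0.138 / Real.log q') := Real.rpow_pos_of_pos (by positivity) _
    positivity
  refine min_le_min le_rfl ?_
  rw [show 0.520 * Real.log q' * (1 + Real.log q / Real.log q') ^ 2 *
      ((q : ℝ) * q') ^ (0.138 / Real.log q') = 0.520 * (Real.log q' * (1 + Real.log q / Real.log q') ^ 2 *
      ((q : ℝ) * q') ^ (0.138 / Real.log q')) by ring,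
    show 0.5 * Real.log q' * (1 + Real.log q / Real.log q') ^ 2 *
      ((q : ℝ) * q') ^ (0.138 / Real.log q') = 0.5 * (Real.log q' * (1 + Real.log q / Real.log q') ^ 2 *
      ((q : ℝ) * q') ^ (0.138 / Real.log q')) by ring]
  exact one_div_le_one_div_of_le (by positivity) (by nlinarith)

end Literature.NumberTheory.LFunctions

end
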